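import Literature.MathematicalPhysics.QuantumFieldTheory.Balaban1983to89.B14LettersScaleNLocal

/-!
# `Balaban1983to89.B14.LettersScaleNLocal` (pieces) — the four letters of `…B14.Eq349IrrelevantFeed.
# perPointIrrelevant_of_charts` and that consumer END TO END under LOCAL hypotheses: (2.38) «on □∩X» (p. 261) and the
# (I.3.32) Hölder letter «in the L⁻ⁿ-scale» (p. 280) assumed only on a box of the fine lattice around the window of `z`

HONEST FRAMING (cell `pub-ymgap`, Track A DAG node N11 = [B14]; count-neutral SLOT input): the sibling of
`…B14LettersScaleNLocal` (same namespace): a fidelity upgrade of the landed knit `…B14.LettersScaleN` §2–§3, §5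
(hypotheses on a box instead of on all of `ℤ^d`); no new estimate of Bałaban's is claimed; the flat-background / `ℤ^d`
model of the [I]-side files is inherited; Bałaban's `U_k` are not instantiated; one finite T⁴ programme at fixed ε;
nothing here is a claim about the continuum, ℝ⁴, OS axioms, a mass gap or the Clay problem.

CITATION HEADER (lean-in-tree rule).  [Balaban1988Convergent] = T. Bałaban, Commun. Math. Phys. **119** (1988) 243–285
(«[III]»; held `paper:balaban1988-cmp119-convergent-renormalization`, journal page = PDF page + 242): (2.38) p. 261,
p. 276, (3.49) p. 280, p. 281; [Balaban1987RG1] = Commun. Math. Phys. **109** (1987) 249–301 («[I]»): (4.16)–(4.18)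
p. 285, (4.23) p. 286 — verbatim quotations in `…B14.LettersScaleN`.  THE PRINT used here, verbatim, [III] p. 280: *«we
move the factors B to the point z instead of the point x»*; p. 281: *«(the irrelevant terms) above, and in (3.49), denotes
the sum of terms which can be bounded by O((LʲL⁻ⁿ)^{5−β}) exp(−κd_j(X))»*.

WHAT IS PROVED (kernel-checked, theorems only, no `def`, no `sorry`, standard axioms).  §4 the discrete Taylor estimates
of `…B14.LettersScaleN` §2 in LOCAL form (`norm_sub_le_l1dist_mul_local`, `norm_taylor2_le_l1dist_sq_mul_local`: the
differences assumed at base points of a box containing `x` and `z`; the lattice path towards `z` stays in the box).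
§5 the four pieces `c = B(z)`, `λ_z`, `ℓ`, `B − c − ℓ` on a window `ι : T → ℤ^d` of ℓ¹-radius `R ∈ ℕ` about `z`, with
ALL letters of `A` assumed only on the fine box `[lo, hi] ⊇ [Lʲ(z − R𝟙), Lʲ(z + R𝟙) + 4Lʲ𝟙]`
(`norm_piece_{c,lam,ell,rem}_le_local`; constants as in the global file).  §6 `pieces_printedShape_local` (the consumer's
literal rpow shape, one letter `a⋆`) and `perPointIrrelevant_of_letters_local` — `perPointIrrelevant_of_charts` END TO END
with its pieces taken to be the window field (definitional hypotheses, `rfl`) and its four letters discharged from the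
LOCAL letters, for any `a ≥ a⋆`.

WHAT IS NOT PROVED HERE (and not claimed): as the sibling and `…B14.LettersScaleN`.
Unit `pub-ymgap-dag-n11-b` (generation 2), HOME `run/shared/lean/pub/pub-ymgap/`.

## References
* [Balaban1988Convergent] T. Bałaban, Commun. Math. Phys. 119 (1988) 243–285: (2.38) p.261, p.276, (3.49) p.280, p.281.
* [Balaban1987RG1] T. Bałaban, Commun. Math. Phys. 109 (1987) 249–301 ([I]: (4.16)–(4.18) p.285, (4.23) p.286).
* [Balaban1985Averaging] T. Bałaban, Commun. Math. Phys. 98 (1985) 17–51 ([7]: through the [I]-side files).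
-/

noncomputable section

open scoped BigOperators
open Finset
open Literature.MathematicalPhysics.QuantumFieldTheory.Balaban1983to89
open Literature.MathematicalPhysics.QuantumFieldTheory.Balaban1983to89.B7Prop1Explicit (e)
open Literature.MathematicalPhysics.QuantumFieldTheory.Balaban1983to89.B7Prop1Local (InBox AgreeOn loK bondHiK)
open Literature.MathematicalPhysics.QuantumFieldTheory.Balaban1983to89.B7Prop3Flat (insCfg)
open Literature.MathematicalPhysics.QuantumFieldTheory.Balaban1983to89.B7Prop4Flat (logIter)
open Literature.MathematicalPhysics.QuantumFieldTheory.Balaban1983to89.B7Prop5Flat (C3 C3_pos logIter_congr restr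
  mem_bondsIn mem_boxFinset BondIn)
open Literature.MathematicalPhysics.QuantumFieldTheory.Balaban1983to89.B7Prop5FlatOperator (avgMap avgMap_apply
  norm_insCfg_le_of_le analyticAt_avgMap_apply differentiableAt_avgMap_real opNorm_fderiv_real_avgMap_le)
open Literature.MathematicalPhysics.QuantumFieldTheory.Balaban1983to89.B12Ineq417Flat (shiftCfg shiftCfg_apply
  logIter_shiftCfg norm_shiftCfg_sub_le locB dlocB boxBonds oneBond theBond logIter_eq_avgMap_restr norm_logIter_le
  norm_logIter_shift_sub_le ineq417_flat_scaled)
open Literature.MathematicalPhysics.QuantumFieldTheory.Balaban1983to89.B12Ineq418Flat (ddlocB eq418_split dd2Cfg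
  dd2Cfg_eq_sum secondDiff_logIter_eq norm_secondDiff_le)

namespace Literature.MathematicalPhysics.QuantumFieldTheory.Balaban1983to89.B14.LettersScaleNLocal

variable {d : ℕ}

/-! ## §4. Discrete Taylor on a box of `ℤ^d` (local form of `B14LettersScaleN` §2) -/

section TaylorLocal

variable {V : Type*} [SeminormedAddCommGroup V]

omit [SeminormedAddCommGroup V] in
/-- One unit step changes one coordinate. [folklore] -/
private theorem sub_add_e_apply' (x z : B7Prop1Explicit.Site d) (i k : Fin d) :
    (x + e i) k - z k = (x k - z k) + (if k = i then 1 else 0) := by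
  rw [Pi.add_apply, B7Prop1Explicit.e_apply]; ring

omit [SeminormedAddCommGroup V] in
/-- One unit step backwards changes one coordinate. [folklore] -/
private theorem sub_sub_e_apply' (x z : B7Prop1Explicit.Site d) (i k : Fin d) :
    (x - e i) k - z k = (x k - z k) - (if k = i then 1 else 0) := by
  rw [Pi.sub_apply, B7Prop1Explicit.e_apply]; ring

omit [SeminormedAddCommGroup V] in
/-- The ℓ¹-distance to `z` drops by one after a unit step towards `z` from below. [folklore] -/
private theorem l1_step_up' {x z : B7Prop1Explicit.Site d} {i : Fin d} (hi : x i < z i) :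
    ∑ k, |(x + e i) k - z k| = ∑ k, |x k - z k| - 1 := by
  rw [Fintype.sum_eq_add_sum_compl i, Fintype.sum_eq_add_sum_compl i (fun k => |x k - z k|)]
  have hc : ∑ k ∈ ({i}ᶜ : Finset (Fin d)), |(x + e i) k - z k| = ∑ k ∈ ({i}ᶜ : Finset (Fin d)), |x k - z k| := by
    refine Finset.sum_congr rfl fun k hk => ?_
    have hki : k ≠ i := by simpa using hk
    rw [sub_add_e_apply', if_neg hki, add_zero]
  rw [hc, sub_add_e_apply', if_pos rfl, abs_of_nonpos (by omega), abs_of_neg (by omega)]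
  ring

omit [SeminormedAddCommGroup V] in
/-- The ℓ¹-distance to `z` drops by one after a unit step towards `z` from above. [folklore] -/
private theorem l1_step_down' {x z : B7Prop1Explicit.Site d} {i : Fin d} (hi : z i < x i) :
    ∑ k, |(x - e i) k - z k| = ∑ k, |x k - z k| - 1 := by
  rw [Fintype.sum_eq_add_sum_compl i, Fintype.sum_eq_add_sum_compl i (fun k => |x k - z k|)]
  have hc : ∑ k ∈ ({i}ᶜ : Finset (Fin d)), |(x - e i) k - z k| = ∑ k ∈ ({i}ᶜ : Finset (Fin d)), |x k - z k| := by
    refine Finset.sum_congr rfl fun k hk => ?_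
    have hki : k ≠ i := by simpa using hk
    rw [sub_sub_e_apply', if_neg hki, sub_zero]
  rw [hc, sub_sub_e_apply', if_pos rfl, abs_of_nonneg (by omega), abs_of_pos (by omega)]
  ring

omit [SeminormedAddCommGroup V] in
/-- A point at positive ℓ¹-distance from `z` differs from `z` in some coordinate. [folklore] -/
private theorem exists_ne_of_l1_pos' {x z : B7Prop1Explicit.Site d} (h : 0 < ∑ k, |x k - z k|) : ∃ i, x i ≠ z i := by
  by_contra hcon
  push Not at hcon
  have : ∑ k, |x k - z k| = 0 := Finset.sum_eq_zero fun k _ => by simp [hcon k]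
  omega

omit [SeminormedAddCommGroup V] in
/-- A point at ℓ¹-distance `0` from `z` is `z`. [folklore] -/
private theorem eq_of_l1_zero' {x z : B7Prop1Explicit.Site d} (h : ∑ k, |x k - z k| = 0) : x = z := by
  funext k
  have hk := (Finset.sum_eq_zero_iff_of_nonneg fun k _ => abs_nonneg (x k - z k)).mp h k (Finset.mem_univ k)
  have := abs_eq_zero.mp hk
  omega

omit [SeminormedAddCommGroup V] in
/-- A unit step towards `z` from below stays in any box containing `x` and `z`. [folklore] -/
private theorem inBox_step_up {blo bhi x z : B7Prop1Explicit.Site d} {i : Fin d} (hx : InBox blo bhi x)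
    (hz : InBox blo bhi z) (hi : x i < z i) : InBox blo bhi (x + e i) := fun k => by
  obtain ⟨h1, h2⟩ := hx k
  obtain ⟨h3, h4⟩ := hz k
  rw [Pi.add_apply, B7Prop1Explicit.e_apply]
  by_cases hk : k = i
  · subst hk; simp only [if_true]; constructor <;> omega
  · simp only [if_neg hk, add_zero]; exact ⟨h1, h2⟩

omit [SeminormedAddCommGroup V] in
/-- A unit step towards `z` from above stays in any box containing `x` and `z`. [folklore] -/
private theorem inBox_step_down {blo bhi x z : B7Prop1Explicit.Site d} {i : Fin d} (hx : InBox blo bhi x)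
    (hz : InBox blo bhi z) (hi : z i < x i) : InBox blo bhi (x - e i) := fun k => by
  obtain ⟨h1, h2⟩ := hx k
  obtain ⟨h3, h4⟩ := hz k
  rw [Pi.sub_apply, B7Prop1Explicit.e_apply]
  by_cases hk : k = i
  · subst hk; simp only [if_true]; constructor <;> omega
  · simp only [if_neg hk, sub_zero]; exact ⟨h1, h2⟩

/-- **First-order discrete Taylor, LOCAL**: unit differences of `f` bounded by `s₁` at base points of a box containing
`x` and `z` give `‖f(x) − f(z)‖ ≤ |x − z|₁·s₁` (the lattice path towards `z` stays in the box) — local form of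
`…B14.LettersScaleN.norm_sub_le_l1dist_mul`, the lattice calculus behind «we move the factors B to the point z»
(p. 280). [cite: Balaban1988Convergent, (3.49) p.280] (elementary API for the relocation to `z`; our proof) -/
theorem norm_sub_le_l1dist_mul_local (f : B7Prop1Explicit.Site d → V) {s₁ : ℝ} {blo bhi : B7Prop1Explicit.Site d}
    (h1 : ∀ y, InBox blo bhi y → ∀ ν, ‖f (y + e ν) - f y‖ ≤ s₁) {x z : B7Prop1Explicit.Site d}
    (hx : InBox blo bhi x) (hz : InBox blo bhi z) :
    ‖f x - f z‖ ≤ ((∑ k, |x k - z k| : ℤ) : ℝ) * s₁ := by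
  suffices H : ∀ N : ℕ, ∀ x : B7Prop1Explicit.Site d, InBox blo bhi x → ∑ k, |x k - z k| = N →
      ‖f x - f z‖ ≤ (N : ℝ) * s₁ by
    have hnn : 0 ≤ ∑ k, |x k - z k| := Finset.sum_nonneg fun k _ => abs_nonneg _
    have h := H (∑ k, |x k - z k|).toNat x hx (Int.toNat_of_nonneg hnn).symm
    rwa [show (((∑ k, |x k - z k|).toNat : ℕ) : ℝ) = ((∑ k, |x k - z k| : ℤ) : ℝ) by
      exact_mod_cast Int.toNat_of_nonneg hnn] at h
  intro N
  induction N with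
  | zero =>
    intro x _ hxN
    have hxz : x = z := eq_of_l1_zero' (by exact_mod_cast hxN)
    rw [hxz]
    simp
  | succ N ih =>
    intro x hx hxN
    obtain ⟨i, hi⟩ := exists_ne_of_l1_pos' (x := x) (z := z) (by rw [hxN]; positivity)
    rcases lt_or_gt_of_ne hi with hlt | hgt
    · have hd : ∑ k, |(x + e i) k - z k| = N := by rw [l1_step_up' hlt, hxN]; push_cast; ring
      have hs : ‖f x - f (x + e i)‖ ≤ s₁ := by rw [norm_sub_rev]; exact h1 x hx i
      calc ‖f x - f z‖ ≤ ‖f x - f (x + e i)‖ + ‖f (x + e i) - f z‖ := norm_sub_le_norm_sub_add_norm_sub _ _ _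
        _ ≤ s₁ + (N : ℝ) * s₁ := add_le_add hs (ih _ (inBox_step_up hx hz hlt) hd)
        _ = ((N + 1 : ℕ) : ℝ) * s₁ := by push_cast; ring
    · have hd : ∑ k, |(x - e i) k - z k| = N := by rw [l1_step_down' hgt, hxN]; push_cast; ring
      have hx' : InBox blo bhi (x - e i) := inBox_step_down hx hz hgt
      have hs : ‖f x - f (x - e i)‖ ≤ s₁ := by
        have h := h1 (x - e i) hx' i
        rwa [sub_add_cancel] at h
      calc ‖f x - f z‖ ≤ ‖f x - f (x - e i)‖ + ‖f (x - e i) - f z‖ := norm_sub_le_norm_sub_add_norm_sub _ _ _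
        _ ≤ s₁ + (N : ℝ) * s₁ := add_le_add hs (ih _ hx' hd)
        _ = ((N + 1 : ℕ) : ℝ) * s₁ := by push_cast; ring

variable [NormedSpace ℝ V]

/-- The linear term after one unit step. [folklore] -/
private theorem sum_smul_step_up' (x z : B7Prop1Explicit.Site d) (i : Fin d) (D : Fin d → V) :
    ∑ ν, (((x + e i) ν - z ν : ℤ) : ℝ) • D ν = ∑ ν, ((x ν - z ν : ℤ) : ℝ) • D ν + D i := by
  have : ∀ ν, (((x + e i) ν - z ν : ℤ) : ℝ) • D ν
      = ((x ν - z ν : ℤ) : ℝ) • D ν + (if ν = i then D ν else 0) := fun ν => by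
    rw [sub_add_e_apply']; push_cast
    rw [add_smul]; split_ifs <;> simp
  simp_rw [this, Finset.sum_add_distrib, Finset.sum_ite_eq', Finset.mem_univ, if_true]

/-- The linear term after one unit step backwards. [folklore] -/
private theorem sum_smul_step_down' (x z : B7Prop1Explicit.Site d) (i : Fin d) (D : Fin d → V) :
    ∑ ν, (((x - e i) ν - z ν : ℤ) : ℝ) • D ν = ∑ ν, ((x ν - z ν : ℤ) : ℝ) • D ν - D i := by
  have : ∀ ν, (((x - e i) ν - z ν : ℤ) : ℝ) • D ν
      = ((x ν - z ν : ℤ) : ℝ) • D ν - (if ν = i then D ν else 0) := fun ν => by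
    rw [sub_sub_e_apply']; push_cast
    rw [sub_smul]; split_ifs <;> simp
  simp_rw [this, Finset.sum_sub_distrib, Finset.sum_ite_eq', Finset.mem_univ, if_true]

/-- **Second-order discrete Taylor, LOCAL**: mixed second differences of `f` bounded by `s₂` at base points of a box
containing `x` and `z` give `‖f(x) − f(z) − Σ_ν(x − z)_ν•(f(z + e_ν) − f(z))‖ ≤ |x − z|₁²·s₂` — local form of
`…B14.LettersScaleN.norm_taylor2_le_l1dist_sq_mul`. [cite: Balaban1988Convergent, (3.49) p.280] (elementary API for
the relocation to `z`; our proof) -/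
theorem norm_taylor2_le_l1dist_sq_mul_local (f : B7Prop1Explicit.Site d → V) {s₂ : ℝ}
    {blo bhi : B7Prop1Explicit.Site d}
    (h2 : ∀ y, InBox blo bhi y → ∀ lam ν, ‖(f (y + e lam + e ν) - f (y + e lam)) - (f (y + e ν) - f y)‖ ≤ s₂)
    {x z : B7Prop1Explicit.Site d} (hx : InBox blo bhi x) (hz : InBox blo bhi z) :
    ‖f x - f z - ∑ ν, ((x ν - z ν : ℤ) : ℝ) • (f (z + e ν) - f z)‖ ≤ ((∑ k, |x k - z k| : ℤ) : ℝ) ^ 2 * s₂ := by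
  suffices H : ∀ N : ℕ, ∀ x : B7Prop1Explicit.Site d, InBox blo bhi x → ∑ k, |x k - z k| = N →
      ‖f x - f z - ∑ ν, ((x ν - z ν : ℤ) : ℝ) • (f (z + e ν) - f z)‖ ≤ (N : ℝ) ^ 2 * s₂ by
    have hnn : 0 ≤ ∑ k, |x k - z k| := Finset.sum_nonneg fun k _ => abs_nonneg _
    have h := H (∑ k, |x k - z k|).toNat x hx (Int.toNat_of_nonneg hnn).symm
    rwa [show (((∑ k, |x k - z k|).toNat : ℕ) : ℝ) = ((∑ k, |x k - z k| : ℤ) : ℝ) by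
      exact_mod_cast Int.toNat_of_nonneg hnn] at h
  intro N
  induction N with
  | zero =>
    intro x _ hxN
    have hxz : x = z := eq_of_l1_zero' (by exact_mod_cast hxN)
    rw [hxz]
    simp
  | succ N ih =>
    intro x hx hxN
    obtain ⟨i, hi⟩ := exists_ne_of_l1_pos' (x := x) (z := z) (by rw [hxN]; positivity)
    have hs₂ : 0 ≤ s₂ := le_trans (norm_nonneg _) (h2 z hz i i)
    -- the `i`-gradient `g(y) = f(y + e_i) − f(y)` has unit differences `≤ s₂` at base points of the box
    have hg : ∀ y, InBox blo bhi y → ∀ ν,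
        ‖(fun y => f (y + e i) - f y) (y + e ν) - (fun y => f (y + e i) - f y) y‖ ≤ s₂ :=
      fun y hy ν => h2 y hy ν i
    rcases lt_or_gt_of_ne hi with hlt | hgt
    · have hd : ∑ k, |(x + e i) k - z k| = N := by rw [l1_step_up' hlt, hxN]; push_cast; ring
      have hT1 : ‖(f (x + e i) - f x) - (f (z + e i) - f z)‖ ≤ ((N : ℝ) + 1) * s₂ := by
        have h := norm_sub_le_l1dist_mul_local (fun y => f (y + e i) - f y) hg hx hz
        rw [hxN] at h
        push_cast at h
        exact h
      have key : f x - f z - ∑ ν, ((x ν - z ν : ℤ) : ℝ) • (f (z + e ν) - f z)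
          = (f (x + e i) - f z - ∑ ν, (((x + e i) ν - z ν : ℤ) : ℝ) • (f (z + e ν) - f z))
            - ((f (x + e i) - f x) - (f (z + e i) - f z)) := by
        rw [sum_smul_step_up']; abel
      rw [key]
      calc ‖(f (x + e i) - f z - ∑ ν, (((x + e i) ν - z ν : ℤ) : ℝ) • (f (z + e ν) - f z))
              - ((f (x + e i) - f x) - (f (z + e i) - f z))‖
          ≤ ‖f (x + e i) - f z - ∑ ν, (((x + e i) ν - z ν : ℤ) : ℝ) • (f (z + e ν) - f z)‖
              + ‖(f (x + e i) - f x) - (f (z + e i) - f z)‖ := norm_sub_le _ _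
        _ ≤ (N : ℝ) ^ 2 * s₂ + ((N : ℝ) + 1) * s₂ := add_le_add (ih _ (inBox_step_up hx hz hlt) hd) hT1
        _ ≤ ((N + 1 : ℕ) : ℝ) ^ 2 * s₂ := by push_cast; nlinarith
    · have hd : ∑ k, |(x - e i) k - z k| = N := by rw [l1_step_down' hgt, hxN]; push_cast; ring
      have hx' : InBox blo bhi (x - e i) := inBox_step_down hx hz hgt
      have hxe : x - e i + e i = x := sub_add_cancel x (e i)
      have hT1 : ‖(f (x - e i + e i) - f (x - e i)) - (f (z + e i) - f z)‖ ≤ (N : ℝ) * s₂ := by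
        have h := norm_sub_le_l1dist_mul_local (fun y => f (y + e i) - f y) hg hx' hz
        rw [hd] at h
        push_cast at h
        exact h
      have key : f x - f z - ∑ ν, ((x ν - z ν : ℤ) : ℝ) • (f (z + e ν) - f z)
          = (f (x - e i) - f z - ∑ ν, (((x - e i) ν - z ν : ℤ) : ℝ) • (f (z + e ν) - f z))
            + ((f (x - e i + e i) - f (x - e i)) - (f (z + e i) - f z)) := by
        rw [sum_smul_step_down', hxe]; abel
      rw [key]
      calc ‖(f (x - e i) - f z - ∑ ν, (((x - e i) ν - z ν : ℤ) : ℝ) • (f (z + e ν) - f z))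
              + ((f (x - e i + e i) - f (x - e i)) - (f (z + e i) - f z))‖
          ≤ ‖f (x - e i) - f z - ∑ ν, (((x - e i) ν - z ν : ℤ) : ℝ) • (f (z + e ν) - f z)‖
              + ‖(f (x - e i + e i) - f (x - e i)) - (f (z + e i) - f z)‖ := norm_add_le _ _
        _ ≤ (N : ℝ) ^ 2 * s₂ + (N : ℝ) * s₂ := add_le_add (ih _ hx' hd) hT1
        _ ≤ ((N + 1 : ℕ) : ℝ) ^ 2 * s₂ := by push_cast; nlinarith

end TaylorLocal

/-! ## §5. The four pieces and the (3.49) consumer under LOCAL hypotheses -/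

section PiecesLocal

variable {V : Type*} [SeminormedAddCommGroup V] [NormedSpace ℝ V]

/-- `‖Σ_ν c_ν•v_ν‖ ≤ R·M` for integer coefficients with `Σ|c_ν| ≤ R` and `‖v_ν‖ ≤ M`, `M ≥ 0`. [folklore] -/
private theorem norm_sum_zsmul_le' {ι' : Type*} [Fintype ι'] (c : ι' → ℤ) (v : ι' → V) {M R : ℝ} (hM : 0 ≤ M)
    (hv : ∀ i, ‖v i‖ ≤ M) (hc : ((∑ i, |c i| : ℤ) : ℝ) ≤ R) :
    ‖∑ i, ((c i : ℤ) : ℝ) • v i‖ ≤ R * M := by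
  calc ‖∑ i, ((c i : ℤ) : ℝ) • v i‖ ≤ ∑ i, ‖((c i : ℤ) : ℝ) • v i‖ := norm_sum_le _ _
    _ ≤ ∑ i, ((|c i| : ℤ) : ℝ) * M := Finset.sum_le_sum fun i _ => by
        rw [norm_smul, Real.norm_eq_abs, Int.cast_abs]
        exact mul_le_mul_of_nonneg_left (hv i) (abs_nonneg _)
    _ = ((∑ i, |c i| : ℤ) : ℝ) * M := by push_cast; rw [Finset.sum_mul]
    _ ≤ R * M := mul_le_mul_of_nonneg_right hc hM

variable {𝔸 : Type*} [NormedRing 𝔸] [NormedAlgebra ℂ 𝔸] [CompleteSpace 𝔸] {T : Type*} [Fintype T]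

omit [NormedRing 𝔸] [NormedAlgebra ℂ 𝔸] [CompleteSpace 𝔸] [Fintype T] in
/-- A window point at ℓ¹-distance `≤ R` from `z` lies in the coarse box `[z − R𝟙, z + R𝟙]`. [folklore] -/
private theorem inBox_of_l1 {z x : B7Prop1Explicit.Site d} {R : ℕ} (h : ∑ k, |x k - z k| ≤ (R : ℤ)) :
    InBox (fun i => z i - R) (fun i => z i + R) x := fun i => by
  have hi : |x i - z i| ≤ R :=
    (Finset.single_le_sum (fun k _ => abs_nonneg (x k - z k)) (Finset.mem_univ i)).trans h
  constructor <;> [linarith [neg_abs_le (x i - z i)]; linarith [le_abs_self (x i - z i)]]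

omit [NormedRing 𝔸] [NormedAlgebra ℂ 𝔸] [CompleteSpace 𝔸] [Fintype T] in
/-- From the fine-box containment `[Lʲ(z − R𝟙), Lʲ(z + R𝟙) + 4Lʲ𝟙] ⊆ [lo, hi]`: every coarse point `y` of
`[z − R𝟙, z + R𝟙]` has `[Lʲy, Lʲy + (Lʲ−1)𝟙 + Lʲe_μ + 2Lʲ𝟙] ⊆ [lo, hi]`. [folklore] (bookkeeping) -/
private theorem hW_of_coarse {L j : ℕ} (hL : 1 ≤ L) {z lo hi : B7Prop1Explicit.Site d} {R : ℕ}
    (hWfine : ∀ i, lo i ≤ (L : ℤ) ^ j * (z i - R) ∧ (L : ℤ) ^ j * (z i + R) + 4 * (L : ℤ) ^ j ≤ hi i)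
    {y : B7Prop1Explicit.Site d} (hy : InBox (fun i => z i - R) (fun i => z i + R) y) (μ : Fin d) :
    ∀ i, lo i ≤ loK L j y i ∧ bondHiK L j y μ i + 2 * (L : ℤ) ^ j ≤ hi i := by
  intro i
  obtain ⟨h1, h2⟩ := hWfine i
  obtain ⟨h3, h4⟩ := hy i
  have hLj : (1 : ℤ) ≤ (L : ℤ) ^ j := by exact_mod_cast Nat.one_le_pow j L (by omega)
  have h5 : (L : ℤ) ^ j * (z i - R) ≤ (L : ℤ) ^ j * y i := mul_le_mul_of_nonneg_left h3 (by linarith)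
  have h6 : (L : ℤ) ^ j * y i ≤ (L : ℤ) ^ j * (z i + R) := mul_le_mul_of_nonneg_left h4 (by linarith)
  simp only [loK, bondHiK]
  constructor
  · linarith
  · split_ifs <;> linarith

/-- **Piece `c = B(z)`, LOCAL hypotheses**: `‖c‖ ≤ 2a·LʲL⁻ⁿ` with `‖A‖ ≤ a` assumed only on the fine box
`[lo, hi] ⊇ [Lʲ(z − R𝟙), Lʲ(z + R𝟙) + 4Lʲ𝟙]`. [cite: Balaban1988Convergent, (2.38) p.261, p.280; Balaban1987RG1, (4.16) p.285] -/
theorem norm_piece_c_le_local (ζ : B7Prop1Explicit.Site d → ℝ) (L : ℕ) (hL : 2 ≤ L)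
    (A : B7Prop1Explicit.Site d → Fin d → 𝔸) (j n : ℕ) (z : B7Prop1Explicit.Site d) {η a : ℝ}
    (hη : η = ((L : ℝ) ^ n)⁻¹) (ha : 0 ≤ a) (hk : C3 d L * ((L : ℝ) ^ j * (η * a)) ≤ 1)
    {lo hi : B7Prop1Explicit.Site d} {R : ℕ}
    (hWfine : ∀ i, lo i ≤ (L : ℤ) ^ j * (z i - R) ∧ (L : ℤ) ^ j * (z i + R) + 4 * (L : ℤ) ^ j ≤ hi i)
    (hA : ∀ x, InBox lo hi x → ∀ κ, ‖A x κ‖ ≤ a) (hζ0 : |ζ z| ≤ 1) :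
    ‖(fun (μ : Fin d) (_ : T) => locB ζ L ((η : ℂ) • A) j z μ)‖ ≤ 2 * a * ((L : ℝ) ^ j * ((L : ℝ) ^ n)⁻¹) := by
  have hL1 : 1 ≤ L := le_trans (by norm_num) hL
  have hL0 : (0 : ℝ) < L := by exact_mod_cast lt_of_lt_of_le (by norm_num) hL
  have hσ0 : 0 ≤ 2 * a * ((L : ℝ) ^ j * ((L : ℝ) ^ n)⁻¹) := by positivity
  have hz : InBox (fun i => z i - R) (fun i => z i + R) z := fun i => by constructor <;> simp
  refine (pi_norm_le_iff_of_nonneg hσ0).2 fun μ => (pi_norm_le_iff_of_nonneg hσ0).2 fun _ => ?_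
  have hW := hW_of_coarse hL1 hWfine hz μ
  have hbox : ∀ i, lo i ≤ hi i := fun i => by
    obtain ⟨h1, h2⟩ := hW i
    have hLj : (1 : ℤ) ≤ (L : ℤ) ^ j := by exact_mod_cast Nat.one_le_pow j L (by omega)
    simp only [loK, bondHiK] at h1 h2
    split_ifs at h2 <;> nlinarith
  have hblk : ∀ i, lo i ≤ loK L j z i ∧ bondHiK L j z μ i ≤ hi i := fun i => by
    obtain ⟨h1, h2⟩ := hW i
    have hLj : (0 : ℤ) ≤ (L : ℤ) ^ j := by positivity
    exact ⟨h1, by linarith⟩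
  exact norm_locB_scaleN_local ζ L hL A j n z μ hη ha hk hbox hblk hA hζ0

/-- **Piece `λ_z`** (the linear gauge function of (I.4.23)) **, LOCAL hypotheses**: `‖λ_z‖ ≤ R·2a·LʲL⁻ⁿ` on a window of
ℓ¹-radius `R`. [cite: Balaban1987RG1, (4.23) p.286; Balaban1988Convergent, (2.38) p.261, p.280] -/
theorem norm_piece_lam_le_local (ζ : B7Prop1Explicit.Site d → ℝ) (L : ℕ) (hL : 2 ≤ L)
    (A : B7Prop1Explicit.Site d → Fin d → 𝔸) (j n : ℕ) (z : B7Prop1Explicit.Site d) {η a : ℝ}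
    (hη : η = ((L : ℝ) ^ n)⁻¹) (ha : 0 ≤ a) (hk : C3 d L * ((L : ℝ) ^ j * (η * a)) ≤ 1)
    {lo hi : B7Prop1Explicit.Site d} {R : ℕ}
    (hWfine : ∀ i, lo i ≤ (L : ℤ) ^ j * (z i - R) ∧ (L : ℤ) ^ j * (z i + R) + 4 * (L : ℤ) ^ j ≤ hi i)
    (hA : ∀ x, InBox lo hi x → ∀ κ, ‖A x κ‖ ≤ a) (hζ0 : |ζ z| ≤ 1)
    (ι : T → B7Prop1Explicit.Site d) (hι : ∀ t, ∑ k, |ι t k - z k| ≤ (R : ℤ)) :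
    ‖(fun t : T => ∑ ν, ((ι t ν - z ν : ℤ) : ℝ) • locB ζ L ((η : ℂ) • A) j z ν)‖
      ≤ R * (2 * a * ((L : ℝ) ^ j * ((L : ℝ) ^ n)⁻¹)) := by
  have hL0 : (0 : ℝ) < L := by exact_mod_cast lt_of_lt_of_le (by norm_num) hL
  have hσ0 : 0 ≤ 2 * a * ((L : ℝ) ^ j * ((L : ℝ) ^ n)⁻¹) := by positivity
  have hc := norm_piece_c_le_local (T := T) ζ L hL A j n z hη ha hk hWfine hA hζ0
  refine (pi_norm_le_iff_of_nonneg (mul_nonneg (Nat.cast_nonneg R) hσ0)).2 fun t => ?_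
  refine norm_sum_zsmul_le' (fun ν => ι t ν - z ν) _ hσ0 (fun ν => ?_) (by exact_mod_cast hι t)
  have h1 := (pi_norm_le_iff_of_nonneg hσ0).1 hc ν
  exact (pi_norm_le_iff_of_nonneg hσ0).1 h1 t

/-- **Piece `ℓ`, LOCAL hypotheses**: `‖ℓ‖ ≤ R·(2c₁a + 4da′)·(LʲL⁻ⁿ)²` with the (2.38)-shaped letters of `A` assumed only on
the fine box `[lo, hi] ⊇ [Lʲ(z − R𝟙), Lʲ(z + R𝟙) + 4Lʲ𝟙]` (`ineq417_scaleN_local` at `z` in every direction).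
[cite: Balaban1988Convergent, (2.38) p.261, p.276; Balaban1987RG1, (4.17) p.285] -/
theorem norm_piece_ell_le_local (ζ : B7Prop1Explicit.Site d → ℝ) (L : ℕ) (hL : 2 ≤ L)
    (A : B7Prop1Explicit.Site d → Fin d → 𝔸) (j n : ℕ) (z : B7Prop1Explicit.Site d) {η a a' c₁ : ℝ}
    (hη : η = ((L : ℝ) ^ n)⁻¹) (ha : 0 ≤ a) (ha' : 0 ≤ a') (hc₁ : 0 ≤ c₁)
    (hk : C3 d L * ((L : ℝ) ^ j * (η * a)) ≤ 1)
    {lo hi : B7Prop1Explicit.Site d} {R : ℕ}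
    (hWfine : ∀ i, lo i ≤ (L : ℤ) ^ j * (z i - R) ∧ (L : ℤ) ^ j * (z i + R) + 4 * (L : ℤ) ^ j ≤ hi i)
    (hA : ∀ x, InBox lo hi x → ∀ κ, ‖A x κ‖ ≤ a)
    (hA' : ∀ x (ν : Fin d), InBox lo hi x → InBox lo hi (x + e ν) → ∀ κ, ‖A (x + e ν) κ - A x κ‖ ≤ η * a')
    (hζ0 : ∀ y, |ζ y| ≤ 1) (hζ1 : ∀ y ν, |ζ (y + e ν) - ζ y| ≤ c₁ * ((L : ℝ) ^ j * η))
    (ι : T → B7Prop1Explicit.Site d) (hι : ∀ t, ∑ k, |ι t k - z k| ≤ (R : ℤ)) :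
    ‖(fun (μ : Fin d) (t : T) => ∑ ν, ((ι t ν - z ν : ℤ) : ℝ) • dlocB ζ L ((η : ℂ) • A) j ν z μ)‖
      ≤ R * ((2 * c₁ * a + 4 * d * a') * ((L : ℝ) ^ j * ((L : ℝ) ^ n)⁻¹) ^ 2) := by
  have hL1 : 1 ≤ L := le_trans (by norm_num) hL
  have hL0 : (0 : ℝ) < L := by exact_mod_cast lt_of_lt_of_le (by norm_num) hL
  have hLj0 : (0 : ℤ) ≤ (L : ℤ) ^ j := by positivity
  have hM : 0 ≤ (2 * c₁ * a + 4 * d * a') * ((L : ℝ) ^ j * ((L : ℝ) ^ n)⁻¹) ^ 2 := by positivity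
  have hz : InBox (fun i => z i - R) (fun i => z i + R) z := fun i => by constructor <;> simp
  have hbox : ∀ i, lo i ≤ hi i := fun i => by
    obtain ⟨h1, h2⟩ := hWfine i
    have hLj : (1 : ℤ) ≤ (L : ℤ) ^ j := by exact_mod_cast Nat.one_le_pow j L (by omega)
    nlinarith
  refine (pi_norm_le_iff_of_nonneg (mul_nonneg (Nat.cast_nonneg R) hM)).2 fun μ =>
    (pi_norm_le_iff_of_nonneg (mul_nonneg (Nat.cast_nonneg R) hM)).2 fun t => ?_
  refine norm_sum_zsmul_le' (fun ν => ι t ν - z ν) _ hM (fun ν => ?_) (by exact_mod_cast hι t)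
  -- the blocks of `z` and `z + e_ν`
  have hWz := hW_of_coarse hL1 hWfine hz μ
  have hWzν : ∀ i, lo i ≤ loK L j (z + e ν) i ∧ bondHiK L j (z + e ν) μ i ≤ hi i := fun i => by
    obtain ⟨h1, h2⟩ := hWfine i
    have hR : (0 : ℤ) ≤ R := Nat.cast_nonneg R
    have hzle : z i - R ≤ (z + e ν) i ∧ (z + e ν) i ≤ z i + 1 := by
      rw [Pi.add_apply, B7Prop1Explicit.e_apply]; split_ifs <;> constructor <;> linarith
    have h5 : (L : ℤ) ^ j * (z i - R) ≤ (L : ℤ) ^ j * (z + e ν) i := mul_le_mul_of_nonneg_left hzle.1 hLj0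
    have h6 : (L : ℤ) ^ j * (z + e ν) i ≤ (L : ℤ) ^ j * (z i + 1) := mul_le_mul_of_nonneg_left hzle.2 hLj0
    have h7 : (L : ℤ) ^ j * (z i + 1) ≤ (L : ℤ) ^ j * (z i + R) + (L : ℤ) ^ j := by
      have := mul_le_mul_of_nonneg_left (show z i ≤ z i + R by linarith) hLj0
      linarith [mul_add ((L : ℤ) ^ j) (z i) 1, mul_add ((L : ℤ) ^ j) (z i) (R : ℤ)]
    simp only [loK, bondHiK]
    constructor
    · linarith
    · split_ifs <;> linarith
  exact ineq417_scaleN_local ζ L hL A j n ν z μ hη ha ha' hk hbox (fun i => ⟨(hWz i).1, by linarith [(hWz i).2]⟩)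
    hWzν hA (fun x hx hx' κ => hA' x ν hx hx' κ) (hζ0 z) (hζ1 z ν)

/-- **Piece `B − c − ℓ`, LOCAL hypotheses**: `‖B − c − ℓ‖ ≤ R²·(4da″ + 32C₃a′² + 8dc₁a′ + 2c₂a)·(LʲL⁻ⁿ)²θ` with all
letters of `A` assumed only on the fine box `[lo, hi] ⊇ [Lʲ(z − R𝟙), Lʲ(z + R𝟙) + 4Lʲ𝟙]` (`ineq418_scaleN_local` at
every base point of the coarse box `[z − R𝟙, z + R𝟙]` and the local Taylor estimate `norm_taylor2_le_l1dist_sq_mul_local`).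
[cite: Balaban1988Convergent, (2.38) p.261, p.276, p.280; Balaban1987RG1, (4.18) p.285] -/
theorem norm_piece_rem_le_local (ζ : B7Prop1Explicit.Site d → ℝ) (L : ℕ) (hL : 2 ≤ L)
    (A : B7Prop1Explicit.Site d → Fin d → 𝔸) (j n : ℕ) (z : B7Prop1Explicit.Site d)
    {η a a' a'' θ c₁ c₂ : ℝ} (hη : η = ((L : ℝ) ^ n)⁻¹) (ha : 0 ≤ a) (ha' : 0 ≤ a') (ha'' : 0 ≤ a'')
    (hc₁ : 0 ≤ c₁) (hc₂ : 0 ≤ c₂) (hθx : (L : ℝ) ^ j * η ≤ θ) (hθ1 : θ ≤ 1)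
    (hsmall : C3 d L * ((L : ℝ) ^ j * η * (2 * a + 4 * ((L : ℝ) ^ j * η) * a')) ≤ 1)
    {lo hi : B7Prop1Explicit.Site d} {R : ℕ}
    (hWfine : ∀ i, lo i ≤ (L : ℤ) ^ j * (z i - R) ∧ (L : ℤ) ^ j * (z i + R) + 4 * (L : ℤ) ^ j ≤ hi i)
    (hA : ∀ x, InBox lo hi x → ∀ κ, ‖A x κ‖ ≤ a)
    (hA' : ∀ x (ν : Fin d), InBox lo hi x → InBox lo hi (x + e ν) → ∀ κ, ‖A (x + e ν) κ - A x κ‖ ≤ η * a')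
    (hA2 : ∀ y (lam ν : Fin d), InBox lo hi y → InBox lo hi (y + ((L : ℤ) ^ j) • e lam + e ν) → ∀ κ,
      ‖(A (y + ((L : ℤ) ^ j) • e lam + e ν) κ - A (y + ((L : ℤ) ^ j) • e lam) κ) - (A (y + e ν) κ - A y κ)‖
        ≤ η * (a'' * θ))
    (hζ0 : ∀ y, |ζ y| ≤ 1) (hζ1 : ∀ y ν, |ζ (y + e ν) - ζ y| ≤ c₁ * ((L : ℝ) ^ j * η))
    (hζ2 : ∀ y (lam ν : Fin d), |ζ (y + e lam + e ν) - ζ (y + e lam) - ζ (y + e ν) + ζ y|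
      ≤ c₂ * ((L : ℝ) ^ j * η) ^ 2)
    (ι : T → B7Prop1Explicit.Site d) (hι : ∀ t, ∑ k, |ι t k - z k| ≤ (R : ℤ)) :
    ‖(fun (μ : Fin d) (t : T) => locB ζ L ((η : ℂ) • A) j (ι t) μ)
        - (fun (μ : Fin d) (_ : T) => locB ζ L ((η : ℂ) • A) j z μ)
        - (fun (μ : Fin d) (t : T) => ∑ ν, ((ι t ν - z ν : ℤ) : ℝ) • dlocB ζ L ((η : ℂ) • A) j ν z μ)‖
      ≤ (R : ℝ) ^ 2 * ((4 * d * a'' + 32 * C3 d L * a' ^ 2 + 8 * d * c₁ * a' + 2 * c₂ * a)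
          * ((L : ℝ) ^ j * ((L : ℝ) ^ n)⁻¹) ^ 2 * θ) := by
  have hL0 : (0 : ℝ) < L := by exact_mod_cast lt_of_lt_of_le (by norm_num) hL
  have hL1 : 1 ≤ L := le_trans (by norm_num) hL
  have hηpos : 0 < η := by rw [hη]; positivity
  have hθ0 : 0 ≤ θ := le_trans (by positivity) hθx
  have hC3 : 0 ≤ C3 d L := (C3_pos d L hL1).le
  have hM : 0 ≤ (4 * d * a'' + 32 * C3 d L * a' ^ 2 + 8 * d * c₁ * a' + 2 * c₂ * a)
      * ((L : ℝ) ^ j * ((L : ℝ) ^ n)⁻¹) ^ 2 * θ := by positivity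
  have hz : InBox (fun i => z i - R) (fun i => z i + R) z := fun i => by constructor <;> simp
  refine (pi_norm_le_iff_of_nonneg (by positivity)).2 fun μ =>
    (pi_norm_le_iff_of_nonneg (by positivity)).2 fun t => ?_
  simp only [Pi.sub_apply]
  -- second differences of `f = B_μ` at every base point of the coarse box: local (I.4.18)
  have h2 : ∀ y, InBox (fun i => z i - R) (fun i => z i + R) y → ∀ (lam ν : Fin d),
      ‖(locB ζ L ((η : ℂ) • A) j (y + e lam + e ν) μ - locB ζ L ((η : ℂ) • A) j (y + e lam) μ)
      - (locB ζ L ((η : ℂ) • A) j (y + e ν) μ - locB ζ L ((η : ℂ) • A) j y μ)‖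
      ≤ (4 * d * a'' + 32 * C3 d L * a' ^ 2 + 8 * d * c₁ * a' + 2 * c₂ * a)
          * ((L : ℝ) ^ j * ((L : ℝ) ^ n)⁻¹) ^ 2 * θ := by
    intro y hy lam ν
    have h := ineq418_scaleN_local ζ L hL A j n lam ν y μ hη ha ha' ha'' hθx hθ1 hsmall (hW_of_coarse hL1 hWfine hy μ)
      hA hA' (fun y' hy' hy'' κ => hA2 y' lam ν hy' hy'' κ) (hζ0 y) (hζ1 y lam) (hζ1 y ν) (hζ2 y lam ν)
    unfold ddlocB dlocB at h
    exact h
  have hT := norm_taylor2_le_l1dist_sq_mul_local (fun y => locB ζ L ((η : ℂ) • A) j y μ) h2 (inBox_of_l1 (hι t)) hz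
  refine hT.trans (mul_le_mul_of_nonneg_right ?_ hM)
  have h0 : 0 ≤ ((∑ k, |ι t k - z k| : ℤ) : ℝ) := by exact_mod_cast Finset.sum_nonneg fun k _ => abs_nonneg _
  exact pow_le_pow_left₀ h0 (by exact_mod_cast hι t) 2

end PiecesLocal

/-! ## §6. The letters in the consumer's literal shape and the (3.49) consumer END TO END, LOCAL hypotheses -/

section PrintedLocal

/-- `Lʲ(Lⁿ)⁻¹ = L^{(j:ℝ)−n}`. [folklore] -/
private theorem sigma_eq_rpow' {L : ℝ} (hL : 0 < L) (j n : ℕ) : L ^ j * (L ^ n)⁻¹ = L ^ ((j : ℝ) - n) := by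
  rw [Real.rpow_sub hL, Real.rpow_natCast, Real.rpow_natCast, div_eq_mul_inv]

/-- `0 < Lʲ(Lⁿ)⁻¹ ≤ 1` for `L ≥ 1`, `j ≤ n`. [folklore] -/
private theorem sigma_pos_le_one' {L : ℝ} (hL : 1 ≤ L) {j n : ℕ} (hjn : j ≤ n) :
    0 < L ^ j * (L ^ n)⁻¹ ∧ L ^ j * (L ^ n)⁻¹ ≤ 1 := by
  have hL0 : 0 < L := lt_of_lt_of_le one_pos hL
  refine ⟨by positivity, ?_⟩
  rw [← div_eq_mul_inv, div_le_one (by positivity)]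
  exact pow_le_pow_right₀ hL hjn

/-- `σ ≤ σ^{β₀} ≤ 1` for `0 < σ ≤ 1`, `0 ≤ β₀ ≤ 1`. [folklore] -/
private theorem holderTheta_bounds' {σ β₀ : ℝ} (hσ : 0 < σ) (hσ1 : σ ≤ 1) (hβ0 : 0 ≤ β₀) (hβ1 : β₀ ≤ 1) :
    σ ≤ σ ^ β₀ ∧ σ ^ β₀ ≤ 1 := by
  refine ⟨?_, Real.rpow_le_one hσ.le hσ1 hβ0⟩
  calc σ = σ ^ (1 : ℝ) := (Real.rpow_one σ).symm
    _ ≤ σ ^ β₀ := Real.rpow_le_rpow_of_exponent_ge hσ hσ1 hβ1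

variable {𝔸 : Type*} [NormedRing 𝔸] [NormedAlgebra ℂ 𝔸] [CompleteSpace 𝔸] {T : Type*} [Fintype T]

/-- **The four letters of `perPointIrrelevant_of_charts` in its literal shape, LOCAL hypotheses**: as
`B14.LettersScaleN.pieces_printedShape`, with the (2.38)-shaped sizes of `A`, its fine differences and the (I.3.32)
Hölder letter assumed ONLY on the fine box `[lo, hi] ⊇ [Lʲ(z − R𝟙), Lʲ(z + R𝟙) + 4Lʲ𝟙]` around the window (print:
(2.38) holds «on □∩X»); one letter `a⋆ = 2a(1 + R) + R(2c₁a + 4da′) + R²(4da″ + 32C₃a′² + 8dc₁a′ + 2c₂a)`.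
[cite: Balaban1988Convergent, (2.38) p.261, p.276, p.280; Balaban1987RG1, (4.16)–(4.18) p.285] -/
theorem pieces_printedShape_local (ζ : B7Prop1Explicit.Site d → ℝ) (L : ℕ) (hL : 2 ≤ L)
    (A : B7Prop1Explicit.Site d → Fin d → 𝔸) {j n : ℕ} (hjn : j ≤ n) (z : B7Prop1Explicit.Site d)
    {η a a' a'' b c₁ c₂ : ℝ} (hη : η = ((L : ℝ) ^ n)⁻¹) (ha : 0 ≤ a) (ha' : 0 ≤ a') (ha'' : 0 ≤ a'')
    (hb0 : 0 ≤ b) (hb1 : b ≤ 1) (hc₁ : 0 ≤ c₁) (hc₂ : 0 ≤ c₂)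
    (hsmall : C3 d L * ((L : ℝ) ^ j * η * (2 * a + 4 * ((L : ℝ) ^ j * η) * a')) ≤ 1)
    {lo hi : B7Prop1Explicit.Site d} {R : ℕ}
    (hWfine : ∀ i, lo i ≤ (L : ℤ) ^ j * (z i - R) ∧ (L : ℤ) ^ j * (z i + R) + 4 * (L : ℤ) ^ j ≤ hi i)
    (hA : ∀ x, InBox lo hi x → ∀ κ, ‖A x κ‖ ≤ a)
    (hA' : ∀ x (ν : Fin d), InBox lo hi x → InBox lo hi (x + e ν) → ∀ κ, ‖A (x + e ν) κ - A x κ‖ ≤ η * a')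
    (hA2 : ∀ y (lam ν : Fin d), InBox lo hi y → InBox lo hi (y + ((L : ℤ) ^ j) • e lam + e ν) → ∀ κ,
      ‖(A (y + ((L : ℤ) ^ j) • e lam + e ν) κ - A (y + ((L : ℤ) ^ j) • e lam) κ) - (A (y + e ν) κ - A y κ)‖
        ≤ η * (a'' * ((L : ℝ) ^ ((j : ℝ) - n)) ^ (1 - b)))
    (hζ0 : ∀ y, |ζ y| ≤ 1) (hζ1 : ∀ y ν, |ζ (y + e ν) - ζ y| ≤ c₁ * ((L : ℝ) ^ j * η))
    (hζ2 : ∀ y (lam ν : Fin d), |ζ (y + e lam + e ν) - ζ (y + e lam) - ζ (y + e ν) + ζ y|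
      ≤ c₂ * ((L : ℝ) ^ j * η) ^ 2)
    (ι : T → B7Prop1Explicit.Site d) (hι : ∀ t, ∑ k, |ι t k - z k| ≤ (R : ℤ)) :
    ‖(fun (μ : Fin d) (_ : T) => locB ζ L ((η : ℂ) • A) j z μ)‖
        ≤ (2 * a * (1 + R) + R * (2 * c₁ * a + 4 * d * a')
            + R ^ 2 * (4 * d * a'' + 32 * C3 d L * a' ^ 2 + 8 * d * c₁ * a' + 2 * c₂ * a)) * (L : ℝ) ^ ((j : ℝ) - n)
      ∧ ‖(fun t : T => ∑ ν, ((ι t ν - z ν : ℤ) : ℝ) • locB ζ L ((η : ℂ) • A) j z ν)‖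
        ≤ (2 * a * (1 + R) + R * (2 * c₁ * a + 4 * d * a')
            + R ^ 2 * (4 * d * a'' + 32 * C3 d L * a' ^ 2 + 8 * d * c₁ * a' + 2 * c₂ * a)) * (L : ℝ) ^ ((j : ℝ) - n)
      ∧ ‖(fun (μ : Fin d) (t : T) => ∑ ν, ((ι t ν - z ν : ℤ) : ℝ) • dlocB ζ L ((η : ℂ) • A) j ν z μ)‖
        ≤ (2 * a * (1 + R) + R * (2 * c₁ * a + 4 * d * a')
            + R ^ 2 * (4 * d * a'' + 32 * C3 d L * a' ^ 2 + 8 * d * c₁ * a' + 2 * c₂ * a))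
          * ((L : ℝ) ^ ((j : ℝ) - n)) ^ 2
      ∧ ‖(fun (μ : Fin d) (t : T) => locB ζ L ((η : ℂ) • A) j (ι t) μ)
          - (fun (μ : Fin d) (_ : T) => locB ζ L ((η : ℂ) • A) j z μ)
          - (fun (μ : Fin d) (t : T) => ∑ ν, ((ι t ν - z ν : ℤ) : ℝ) • dlocB ζ L ((η : ℂ) • A) j ν z μ)‖
        ≤ (2 * a * (1 + R) + R * (2 * c₁ * a + 4 * d * a')
            + R ^ 2 * (4 * d * a'' + 32 * C3 d L * a' ^ 2 + 8 * d * c₁ * a' + 2 * c₂ * a))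
          * ((L : ℝ) ^ ((j : ℝ) - n)) ^ 2 * ((L : ℝ) ^ ((j : ℝ) - n)) ^ (1 - b) := by
  have hL0 : (0 : ℝ) < L := by exact_mod_cast lt_of_lt_of_le (by norm_num) hL
  have hL1 : (1 : ℝ) ≤ L := by exact_mod_cast le_trans (by norm_num) hL
  have hL1' : 1 ≤ L := le_trans (by norm_num) hL
  have hC3 : 0 ≤ C3 d L := (C3_pos d L hL1').le
  have hR : (0 : ℝ) ≤ R := Nat.cast_nonneg R
  -- the scale letter and the Hölder factor
  have hσ : (L : ℝ) ^ j * ((L : ℝ) ^ n)⁻¹ = (L : ℝ) ^ ((j : ℝ) - n) := sigma_eq_rpow' hL0 j n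
  have hσx : (L : ℝ) ^ j * η = (L : ℝ) ^ ((j : ℝ) - n) := by rw [hη, hσ]
  obtain ⟨hσpos, hσ1⟩ := sigma_pos_le_one' hL1 hjn
  rw [hσ] at hσpos hσ1
  obtain ⟨hθx, hθ1⟩ := holderTheta_bounds' hσpos hσ1 (by linarith : 0 ≤ 1 - b) (by linarith : 1 - b ≤ 1)
  -- b07's smallness for the first-order files follows from the (4.18) one
  have hk : C3 d L * ((L : ℝ) ^ j * (η * a)) ≤ 1 := by
    have hηpos : 0 < η := by rw [hη]; positivity
    have h1 : C3 d L * ((L : ℝ) ^ j * (η * a))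
        ≤ C3 d L * ((L : ℝ) ^ j * η * (2 * a + 4 * ((L : ℝ) ^ j * η) * a')) := by
      apply mul_le_mul_of_nonneg_left _ hC3
      have : 0 ≤ (L : ℝ) ^ j * η := by positivity
      nlinarith [mul_nonneg this ha, mul_nonneg (mul_nonneg this this) ha']
    exact h1.trans hsmall
  -- the common letter dominates each constant
  have hC₁0 : 0 ≤ 2 * c₁ * a + 4 * d * a' := by positivity
  have hC₂0 : 0 ≤ 4 * d * a'' + 32 * C3 d L * a' ^ 2 + 8 * d * c₁ * a' + 2 * c₂ * a := by positivity
  have hRC₁ : 0 ≤ R * (2 * c₁ * a + 4 * d * a') := mul_nonneg hR hC₁0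
  have hRC₂ : 0 ≤ (R : ℝ) ^ 2 * (4 * d * a'' + 32 * C3 d L * a' ^ 2 + 8 * d * c₁ * a' + 2 * c₂ * a) :=
    mul_nonneg (sq_nonneg _) hC₂0
  have hRa : 0 ≤ 2 * a * R := by positivity
  have hstar1 : 2 * a ≤ 2 * a * (1 + R) + R * (2 * c₁ * a + 4 * d * a')
      + R ^ 2 * (4 * d * a'' + 32 * C3 d L * a' ^ 2 + 8 * d * c₁ * a' + 2 * c₂ * a) := by linarith
  have hstar2 : R * (2 * a) ≤ 2 * a * (1 + R) + R * (2 * c₁ * a + 4 * d * a')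
      + R ^ 2 * (4 * d * a'' + 32 * C3 d L * a' ^ 2 + 8 * d * c₁ * a' + 2 * c₂ * a) := by linarith
  have hstar3 : R * (2 * c₁ * a + 4 * d * a') ≤ 2 * a * (1 + R) + R * (2 * c₁ * a + 4 * d * a')
      + R ^ 2 * (4 * d * a'' + 32 * C3 d L * a' ^ 2 + 8 * d * c₁ * a' + 2 * c₂ * a) := by linarith
  have hstar4 : (R : ℝ) ^ 2 * (4 * d * a'' + 32 * C3 d L * a' ^ 2 + 8 * d * c₁ * a' + 2 * c₂ * a)
      ≤ 2 * a * (1 + R) + R * (2 * c₁ * a + 4 * d * a')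
      + R ^ 2 * (4 * d * a'' + 32 * C3 d L * a' ^ 2 + 8 * d * c₁ * a' + 2 * c₂ * a) := by linarith
  have hσ2 : 0 ≤ ((L : ℝ) ^ ((j : ℝ) - n)) ^ 2 := sq_nonneg _
  have hσ3 : 0 ≤ ((L : ℝ) ^ ((j : ℝ) - n)) ^ 2 * ((L : ℝ) ^ ((j : ℝ) - n)) ^ (1 - b) :=
    mul_nonneg hσ2 (le_trans hσpos.le hθx)
  refine ⟨?_, ?_, ?_, ?_⟩
  · have h := norm_piece_c_le_local (T := T) ζ L hL A j n z hη ha hk hWfine hA (hζ0 z)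
    rw [hσ] at h
    exact h.trans (mul_le_mul_of_nonneg_right hstar1 hσpos.le)
  · have h := norm_piece_lam_le_local ζ L hL A j n z hη ha hk hWfine hA (hζ0 z) ι hι
    rw [hσ, ← mul_assoc] at h
    exact h.trans (mul_le_mul_of_nonneg_right hstar2 hσpos.le)
  · have h := norm_piece_ell_le_local ζ L hL A j n z hη ha ha' hc₁ hk hWfine hA hA' hζ0 hζ1 ι hι
    rw [hσ, ← mul_assoc] at h
    exact h.trans (mul_le_mul_of_nonneg_right hstar3 hσ2)
  · have h := norm_piece_rem_le_local ζ L hL A j n z hη ha ha' ha'' hc₁ hc₂ (by rw [hσx]; exact hθx) hθ1 hsmall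
      hWfine hA hA' hA2 hζ0 hζ1 hζ2 ι hι
    rw [hσ] at h
    refine h.trans ?_
    rw [show (R : ℝ) ^ 2 * ((4 * d * a'' + 32 * C3 d L * a' ^ 2 + 8 * d * c₁ * a' + 2 * c₂ * a)
        * ((L : ℝ) ^ ((j : ℝ) - n)) ^ 2 * ((L : ℝ) ^ ((j : ℝ) - n)) ^ (1 - b))
        = ((R : ℝ) ^ 2 * (4 * d * a'' + 32 * C3 d L * a' ^ 2 + 8 * d * c₁ * a' + 2 * c₂ * a))
          * (((L : ℝ) ^ ((j : ℝ) - n)) ^ 2 * ((L : ℝ) ^ ((j : ℝ) - n)) ^ (1 - b)) by ring,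
      show (2 * a * (1 + R) + R * (2 * c₁ * a + 4 * d * a')
          + R ^ 2 * (4 * d * a'' + 32 * C3 d L * a' ^ 2 + 8 * d * c₁ * a' + 2 * c₂ * a))
          * ((L : ℝ) ^ ((j : ℝ) - n)) ^ 2 * ((L : ℝ) ^ ((j : ℝ) - n)) ^ (1 - b)
        = (2 * a * (1 + R) + R * (2 * c₁ * a + 4 * d * a')
          + R ^ 2 * (4 * d * a'' + 32 * C3 d L * a' ^ 2 + 8 * d * c₁ * a' + 2 * c₂ * a))
          * (((L : ℝ) ^ ((j : ℝ) - n)) ^ 2 * ((L : ℝ) ^ ((j : ℝ) - n)) ^ (1 - b)) by ring]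
    exact mul_le_mul_of_nonneg_right hstar4 hσ3

end PrintedLocal

section Eq349Local

open Set Metric NormedSpace
open Literature.MathematicalPhysics.QuantumFieldTheory.Balaban1983to89.B12TreeDecay
open Literature.MathematicalPhysics.QuantumFieldTheory.Balaban1983to89.B14.Eq349IrrelevantFeed (perPointIrrelevant_of_charts)

variable {𝔸 : Type*} [NormedRing 𝔸] [NormedAlgebra ℂ 𝔸] [CompleteSpace 𝔸] {T : Type*} [Fintype T]
  {𝔄 : Type*} [NormedRing 𝔄] [NormedAlgebra ℝ 𝔄] {F : Type*} [NormedAddCommGroup F] [NormedSpace ℂ F] [CompleteSpace F]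

-- (the quadruply nested operator space over the iterated `Pi` type: one more level of pending instance synthesis)
set_option maxSynthPendingDepth 3 in
/-- **The (3.49) irrelevant constituent of the point `z` from the letters at scale `n`, LOCAL hypotheses** — as
`B14.LettersScaleN.perPointIrrelevant_of_letters` but with the (2.38)-shaped sizes, fine differences and the (I.3.32)
Hölder letter of `A` assumed ONLY on the fine box `[lo, hi] ⊇ [Lʲ(z − R𝟙), Lʲ(z + R𝟙) + 4Lʲ𝟙]` (print: «on □∩X»).
[cite: Balaban1988Convergent, p.281, (3.49) p.280, (2.38) p.261, p.276; Balaban1987RG1, (4.16)–(4.18) p.285] -/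
theorem perPointIrrelevant_of_letters_local
    {Sy : LocDomainSys} (G : CubeSystem Sy) {Δ : ℕ} (hΔ : G.DegreeLE Δ) {c₀ : ℝ} (hV : G.VolumeLeaf c₀) {κ : ℝ}
    (hκ : kappa₀ c₀ Δ ≤ κ)
    {𝔤 : Type*} [LieRing 𝔤] [LieAlgebra ℝ 𝔤] (eV : 𝔸 ≃ₗ[ℝ] 𝔤) (ρ : 𝔸 →L[ℝ] 𝔄) {α : ℝ} (hα : 0 < α) {E₀ : ℝ}
    (hE₀ : 0 ≤ E₀) {b : ℝ} (hb0 : 0 ≤ b) (hb : ∀ x y : 𝔸, ‖eV.symm ⁅eV x, eV y⁆‖ ≤ b * ‖x‖ * ‖y‖)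
    {a : ℝ} {C : ℝ}
    (hC : (3 / 2 : ℝ) * (4 / α) ^ 2 * a ^ 2 + (10 / 3 : ℝ) * (4 / α) ^ 2 * a ^ 3 * b
          + (9 / 8 : ℝ) * (4 / α) ^ 2 * a ^ 4 * b ^ 2
          + (5 / 2 : ℝ) * (6 / α) ^ 3 * a ^ 3 + (33 / 8 : ℝ) * (6 / α) ^ 3 * a ^ 4 * b
          + (9 / 4 : ℝ) * (8 / α) ^ 4 * a ^ 4 ≤ C)
    (L : ℕ) (hL : 2 ≤ L) {j n : ℕ} (hjn : j ≤ n) {β : ℝ} (hβ0 : 0 ≤ β) (hβ1 : β ≤ 1)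
    {𝒜 : Finset Sy.Dom} {cz : G.Cube} (h𝒜 : 𝒜 ⊆ G.above cz)
    (ℰ : Sy.Dom → (Fin d → T → 𝔄) → F)
    (hf : ∀ X ∈ 𝒜, AnalyticOnNhd ℂ (fun A' : Fin d → T → 𝔸 => ℰ X (fun ν y => exp (ρ (A' ν y)))) (ball 0 α))
    (hS : ∀ X ∈ 𝒜, ∀ A' ∈ ball (0 : Fin d → T → 𝔸) α,
      ‖ℰ X (fun ν y => exp (ρ (A' ν y)))‖ ≤ E₀ * Real.exp (-κ * Sy.dj X))
    -- the LOCAL letters at scale `n`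
    (ζ : B7Prop1Explicit.Site d → ℝ) (Afine : B7Prop1Explicit.Site d → Fin d → 𝔸) (z : B7Prop1Explicit.Site d)
    {η a₀ a' a'' c₁ c₂ : ℝ} (hη : η = ((L : ℝ) ^ n)⁻¹) (ha₀ : 0 ≤ a₀) (ha' : 0 ≤ a') (ha'' : 0 ≤ a'')
    (hc₁ : 0 ≤ c₁) (hc₂ : 0 ≤ c₂)
    (hsmall : C3 d L * ((L : ℝ) ^ j * η * (2 * a₀ + 4 * ((L : ℝ) ^ j * η) * a')) ≤ 1)
    {lo hi : B7Prop1Explicit.Site d} {R : ℕ}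
    (hWfine : ∀ i, lo i ≤ (L : ℤ) ^ j * (z i - R) ∧ (L : ℤ) ^ j * (z i + R) + 4 * (L : ℤ) ^ j ≤ hi i)
    (hA : ∀ x, InBox lo hi x → ∀ κ', ‖Afine x κ'‖ ≤ a₀)
    (hA' : ∀ x (ν : Fin d), InBox lo hi x → InBox lo hi (x + e ν) → ∀ κ', ‖Afine (x + e ν) κ' - Afine x κ'‖ ≤ η * a')
    (hA2 : ∀ y (la ν : Fin d), InBox lo hi y → InBox lo hi (y + ((L : ℤ) ^ j) • e la + e ν) → ∀ κ',
      ‖(Afine (y + ((L : ℤ) ^ j) • e la + e ν) κ' - Afine (y + ((L : ℤ) ^ j) • e la) κ')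
        - (Afine (y + e ν) κ' - Afine y κ')‖ ≤ η * (a'' * ((L : ℝ) ^ ((j : ℝ) - n)) ^ (1 - β)))
    (hζ0 : ∀ y, |ζ y| ≤ 1) (hζ1 : ∀ y ν, |ζ (y + e ν) - ζ y| ≤ c₁ * ((L : ℝ) ^ j * η))
    (hζ2 : ∀ y (la ν : Fin d), |ζ (y + e la + e ν) - ζ (y + e la) - ζ (y + e ν) + ζ y|
      ≤ c₂ * ((L : ℝ) ^ j * η) ^ 2)
    (ι : T → B7Prop1Explicit.Site d) (hι : ∀ t, ∑ k, |ι t k - z k| ≤ (R : ℤ))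
    (hastar : 2 * a₀ * (1 + R) + R * (2 * c₁ * a₀ + 4 * d * a')
      + R ^ 2 * (4 * d * a'' + 32 * C3 d L * a' ^ 2 + 8 * d * c₁ * a' + 2 * c₂ * a₀) ≤ a)
    -- the consumer's pieces ARE the window field and its Taylor pieces
    (lam : T → 𝔸) (c ℓ B : Fin d → T → 𝔸)
    (hBdef : B = fun μ t => locB ζ L ((η : ℂ) • Afine) j (ι t) μ)
    (hcdef : c = fun μ _ => locB ζ L ((η : ℂ) • Afine) j z μ)
    (hℓdef : ℓ = fun μ t => ∑ ν, ((ι t ν - z ν : ℤ) : ℝ) • dlocB ζ L ((η : ℂ) • Afine) j ν z μ)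
    (hlamdef : lam = fun t => ∑ ν, ((ι t ν - z ν : ℤ) : ℝ) • locB ζ L ((η : ℂ) • Afine) j z ν)
    (i : Sy.Dom → ℝ) (hi : ∀ X ∈ 𝒜, |i X| ≤
      ‖fderiv ℝ (fderiv ℝ (fun A' : Fin d → T → 𝔸 => ℰ X (fun ν y => exp (ρ (A' ν y))))) 0 ℓ (B - c - ℓ)
          + (2 : ℝ)⁻¹ • fderiv ℝ (fderiv ℝ (fun A' : Fin d → T → 𝔸 => ℰ X (fun ν y => exp (ρ (A' ν y))))) 0 (B - c - ℓ) (B - c - ℓ)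
          + (3 : ℝ)⁻¹ • fderiv ℝ (fderiv ℝ (fun A' : Fin d → T → 𝔸 => ℰ X (fun ν y => exp (ρ (A' ν y))))) 0 (B - c - ℓ)
              (fun ν y => eV.symm ⁅eV (lam y), eV (c ν y)⁆)
          + (3 : ℝ)⁻¹ • fderiv ℝ (fderiv ℝ (fun A' : Fin d → T → 𝔸 => ℰ X (fun ν y => exp (ρ (A' ν y))))) 0 (B - c)
              (fun ν y => eV.symm ⁅eV (lam y), eV ((B - c) ν y)⁆ - (2 : ℝ)⁻¹ • eV.symm ⁅eV ((B - c) ν y), eV (c ν y)⁆)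
          + (6 : ℝ)⁻¹ • fderiv ℝ (fderiv ℝ (fderiv ℝ (fun A' : Fin d → T → 𝔸 => ℰ X (fun ν y => exp (ρ (A' ν y)))))) 0 B B (B - c - ℓ)
          + (6 : ℝ)⁻¹ • fderiv ℝ (fderiv ℝ (fderiv ℝ (fun A' : Fin d → T → 𝔸 => ℰ X (fun ν y => exp (ρ (A' ν y)))))) 0 ℓ B (B - c)
          + (6 : ℝ)⁻¹ • fderiv ℝ (fderiv ℝ (fun A' : Fin d → T → 𝔸 => ℰ X (fun ν y => exp (ρ (A' ν y))))) 0 ℓ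
              (fun ν y => eV.symm ⁅eV (lam y), eV ((B - c) ν y)⁆ - (2 : ℝ)⁻¹ • eV.symm ⁅eV ((B - c) ν y), eV (c ν y)⁆)
          + (6 : ℝ)⁻¹ • fderiv ℝ (fderiv ℝ (fun A' : Fin d → T → 𝔸 => ℰ X (fun ν y => exp (ρ (A' ν y))))) 0 (B - c)
              (fun ν y => eV.symm ⁅eV (lam y), eV (ℓ ν y)⁆ - (2 : ℝ)⁻¹ • eV.symm ⁅eV (ℓ ν y), eV (c ν y)⁆)
          + (8 : ℝ)⁻¹ • fderiv ℝ (fderiv ℝ (fun A' : Fin d → T → 𝔸 => ℰ X (fun ν y => exp (ρ (A' ν y))))) 0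
              (fun ν y => eV.symm ⁅eV (lam y), eV (c ν y)⁆)
              (fun ν y => eV.symm ⁅eV (lam y), eV ((B - c) ν y)⁆ - (2 : ℝ)⁻¹ • eV.symm ⁅eV ((B - c) ν y), eV (c ν y)⁆)
          + (8 : ℝ)⁻¹ • fderiv ℝ (fderiv ℝ (fun A' : Fin d → T → 𝔸 => ℰ X (fun ν y => exp (ρ (A' ν y))))) 0 (B - c)
              (fun ν y => eV.symm ⁅eV (lam y), eV (eV.symm ⁅eV (lam y), eV (c ν y)⁆)⁆
                - (2 : ℝ)⁻¹ • eV.symm ⁅eV (eV.symm ⁅eV (lam y), eV (c ν y)⁆), eV (c ν y)⁆)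
          + (8 : ℝ)⁻¹ • fderiv ℝ (fderiv ℝ (fderiv ℝ (fun A' : Fin d → T → 𝔸 => ℰ X (fun ν y => exp (ρ (A' ν y)))))) 0
              (fun ν y => eV.symm ⁅eV (lam y), eV (c ν y)⁆) B (B - c)
          + (8 : ℝ)⁻¹ • fderiv ℝ (fderiv ℝ (fderiv ℝ (fun A' : Fin d → T → 𝔸 => ℰ X (fun ν y => exp (ρ (A' ν y)))))) 0 B B
              (fun ν y => eV.symm ⁅eV (lam y), eV ((B - c) ν y)⁆ - (2 : ℝ)⁻¹ • eV.symm ⁅eV ((B - c) ν y), eV (c ν y)⁆)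
          - (48 : ℝ)⁻¹ • fderiv ℝ (fderiv ℝ (fun A' : Fin d → T → 𝔸 => ℰ X (fun ν y => exp (ρ (A' ν y))))) 0 B
              (fun ν y => eV.symm ⁅eV (B ν y), eV (eV.symm ⁅eV ((B - c) ν y), eV (c ν y)⁆)⁆)
          + (24 : ℝ)⁻¹ • fderiv ℝ (fderiv ℝ (fderiv ℝ (fderiv ℝ (fun A' : Fin d → T → 𝔸 => ℰ X (fun ν y => exp (ρ (A' ν y))))))) 0 B B B (B - c)‖) :
    |∑ X ∈ 𝒜, i X| ≤ (C * E₀ * K₀ c₀ Δ) * ((L : ℝ) ^ ((j : ℝ) - n)) ^ ((5 : ℝ) - β) := by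
  have hL0 : (0 : ℝ) < L := by exact_mod_cast lt_of_lt_of_le (by norm_num) hL
  have hL1 : (1 : ℝ) ≤ L := by exact_mod_cast le_trans (by norm_num) hL
  obtain ⟨h1, h2, h3, h4⟩ := pieces_printedShape_local (T := T) ζ L hL Afine hjn z hη ha₀ ha' ha'' hβ0 hβ1 hc₁ hc₂
    hsmall hWfine hA hA' hA2 hζ0 hζ1 hζ2 ι hι
  have hσ0 : 0 ≤ (L : ℝ) ^ ((j : ℝ) - n) := (Real.rpow_pos_of_pos hL0 _).le
  have hθ0 : 0 ≤ ((L : ℝ) ^ ((j : ℝ) - n)) ^ (1 - β) := (Real.rpow_pos_of_pos (Real.rpow_pos_of_pos hL0 _) _).le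
  have ha : 0 ≤ a := by
    have hL1' : 1 ≤ L := le_trans (by norm_num) hL
    have hC3 : 0 ≤ C3 d L := (C3_pos d L hL1').le
    have hR : (0 : ℝ) ≤ R := Nat.cast_nonneg R
    have : 0 ≤ 2 * a₀ * (1 + R) + R * (2 * c₁ * a₀ + 4 * d * a')
        + R ^ 2 * (4 * d * a'' + 32 * C3 d L * a' ^ 2 + 8 * d * c₁ * a' + 2 * c₂ * a₀) := by positivity
    exact this.trans hastar
  have hcn : ‖c‖ ≤ a * (L : ℝ) ^ ((j : ℝ) - n) := by
    rw [hcdef]; exact h1.trans (mul_le_mul_of_nonneg_right hastar hσ0)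
  have hlam : ‖lam‖ ≤ a * (L : ℝ) ^ ((j : ℝ) - n) := by
    rw [hlamdef]; exact h2.trans (mul_le_mul_of_nonneg_right hastar hσ0)
  have hℓ : ‖ℓ‖ ≤ a * ((L : ℝ) ^ ((j : ℝ) - n)) ^ 2 := by
    rw [hℓdef]; exact h3.trans (mul_le_mul_of_nonneg_right hastar (sq_nonneg _))
  have hr : ‖B - c - ℓ‖ ≤ a * ((L : ℝ) ^ ((j : ℝ) - n)) ^ 2 * ((L : ℝ) ^ ((j : ℝ) - n)) ^ (1 - β) := by
    rw [hBdef, hcdef, hℓdef]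
    refine h4.trans ?_
    have e1 : (2 * a₀ * (1 + R) + R * (2 * c₁ * a₀ + 4 * d * a')
          + R ^ 2 * (4 * d * a'' + 32 * C3 d L * a' ^ 2 + 8 * d * c₁ * a' + 2 * c₂ * a₀))
          * ((L : ℝ) ^ ((j : ℝ) - n)) ^ 2 * ((L : ℝ) ^ ((j : ℝ) - n)) ^ (1 - β)
        = (2 * a₀ * (1 + R) + R * (2 * c₁ * a₀ + 4 * d * a')
          + R ^ 2 * (4 * d * a'' + 32 * C3 d L * a' ^ 2 + 8 * d * c₁ * a' + 2 * c₂ * a₀))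
          * (((L : ℝ) ^ ((j : ℝ) - n)) ^ 2 * ((L : ℝ) ^ ((j : ℝ) - n)) ^ (1 - β)) := by ring
    have e2 : a * ((L : ℝ) ^ ((j : ℝ) - n)) ^ 2 * ((L : ℝ) ^ ((j : ℝ) - n)) ^ (1 - β)
        = a * (((L : ℝ) ^ ((j : ℝ) - n)) ^ 2 * ((L : ℝ) ^ ((j : ℝ) - n)) ^ (1 - β)) := by ring
    rw [e1, e2]
    exact mul_le_mul_of_nonneg_right hastar (mul_nonneg (sq_nonneg _) hθ0)
  exact perPointIrrelevant_of_charts G hΔ hV hκ eV ρ hα hE₀ hb0 hb ha hC hL1 hjn hβ0 hβ1 h𝒜 ℰ hf hS lam c ℓ B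
    hcn hlam hℓ hr i hi

end Eq349Local

end Literature.MathematicalPhysics.QuantumFieldTheory.Balaban1983to89.B14.LettersScaleNLocal

end
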